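import Summits.QuantumFields.BalabanUV.T4Continuum.Support.NE3FrameFreeSlice
import Summits.QuantumFields.BalabanUV.T4Continuum.Support.NE3LandauOrbit
import Summits.QuantumFields.BalabanUV.T4Continuum.Support.PeriodicChoice
import HarnessLib

/-!
# NE3FrameFreeDecompositionPrep (T⁴ programme, node NE3, row Φ6-FLAT of the owner's rulings ρ-g21-3 ∕ ρ-g21-4 (W4), file 1∕3) —
# SKEWNESS OF THE FRAME-KILLING GAUGE, FLAT SUMMATION BY PARTS IN THE BILINEAR `hsR` FORM, THE KERNEL OF `dPot` ON
# CORNER-TRIVIAL PERIODIC FIELDS, AND THE VANISHING PAIRING OF A BLOCKWISE-CONSTANT DIVERGENCE WITH A BLOCK-MEAN-ZERO GAUGE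

NE3 (node U1b) formalisation swarm `b2b-balaban-t4-ne3-formalise-*`, leaf seat `b2b-balaban-t4-ne3-formalise-leaf-02` (gen 5),
row **Φ6-flat** of the owner's design `HOME/t4/b2b-balaban-t4-ne3-p1/g21/D-ne3p1-g21-2.md` §2 («chart L1 on T_♮(W):
`ker d(avg^k)(W) = D_W Ξ₀ ⊕ T_♮(W)` — flat first») as booked by ruling ρ-g21-4 (W4) («Φ6-flat — leaf-02-g5, with leaf-01-g5 as
second∕XREAD»); INTENT in `HOME/CLAIMS.log` 2026-08-20T15:38:09Z.  CONTEXT.  Row NE3-R2's Φ1 (`NE3FramePotGauge` ∕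
`NE3FrameFreeSlice`, p223604 ∕ p223717) gauged the frame potential of a flat k-fold tangent direction away by a CORNER-TRIVIAL gauge
and typed the flat frame-free block-Landau slice `frameFreeBlockLandau L N k` (the owner's `T_♮(1)`); leaf-01-g5's
`NE3FrameFreeSliceUnique` (in tree 15:47Z) proved the trivial-intersection half `dPot Ξ₀ ∩ T_♮(1) = {0}`.  The EXISTENCE half — every
skew periodic tangent `Y` is `−dPot ξ + X` with `ξ` corner-trivial and `X ∈ T_♮(1)` — is the ℓ²-projection of the frame-free
representative onto `dPot Ξ₀₀` (Ξ₀₀ = corner-trivial AND block-mean-zero gauges), files 2∕3.  THIS FILE supplies the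
lattice∕matrix bookkeeping that projection needs, in the tree's real Hilbert–Schmidt currency `NE3CovariantCalculus.hsR`
(all [folklore], 0 sorry, 0 def):
§1 `hsR_smul_left∕right`, `hsR_neg_left`; 𝔲(n)-valuedness of `dPot ξ`, `flatDiv X`, `asum`, `Fhat`, `linQ`, `Qcoarse` and its
   iterates, **`framePot_mem_skewAdjoint`**, `cornerGauge_mem_skewAdjoint`, **`frameKill_mem_skewAdjoint`** (the frame-killing
   gauge of a skew direction is a 𝔲(n)-gauge — needed so that the decomposition stays inside skew fields);
§2 `flatDiv_add_period`, `wrap_eq_self_of_mem` (the wrap map `x ↦ x mod P` is the identity on `periodBox P`);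
§3 **`sum_hsR_dPot`** — flat summation by parts on the period torus in BILINEAR form:
   `Σ_{x∈periodBox P} Σ_μ hsR (Z x μ) (dPot η x μ) = −Σ_{x∈periodBox P} hsR (flatDiv Z x) (η x)` for `P`-periodic `Z`, `η`
   (leaf-04's `NE3LandauOrbit.sum_hsR_gaugeDir` at `flatCfg`; leaf-01-g5's `NE3FrameFreeSliceUnique.sum_nhsNormSq_dPot_eq` is the
   diagonal case `Z = dPot η`);
§4 `eq_apply_zero_of_dPot_eq_zero` (zero coboundary ⇒ constant, `PeriodicChoice.periodic_vec` with period 1) and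
   **`eq_zero_of_sum_nhsNormSq_dPot_eq_zero`**: a `P`-periodic `η` with `η 0 = 0` and `Σ_{box} Σ_μ nhsNormSq (dPot η) = 0` is `0` —
   the Gram form of `dPot` is DEFINITE on corner-trivial periodic fields (positivity ⇒ nondegeneracy in file 2);
§5 **`sum_hsR_eq_zero_of_blockConst`**: a site function `D` that is constant on each `M`-block off its corner pairs to ZERO over
   `periodBox (M·N)` with every corner-trivial block-sum-zero `η` (block tiling `NE3BlockLineAverage.sum_periodBox_blocks`).
HONEST FRAMING.  Flat finite-torus lattice kinematics and linear algebra in our frame; nothing about Bałaban's minimisers, (P♮) at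
`W ≠ 1`, (ML_w), T-E_w or NE3 is asserted; NE3 NOT proved; spine PROVED 0∕9; finite T⁴ rung (B)+1 — NOT infinite volume, NOT mass
gap, NOT BetaPertH, NOT Clay.  ABSOLUTE RULE kept: no printed sentence is a hypothesis (context only: [Balaban1985Averaging] (42),
(47)–(48) p. 25, (112) p. 34, (120)–(125) pp. 35–36; [Balaban1985Variational] (83) p. 290, the Landau restriction).  PLACEMENT:
`Summits/QuantumFields/BalabanUV/`; imports row NE3-R2's Φ1b `NE3FrameFreeSlice`, leaf-04's `NE3LandauOrbit` and leaf-09's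
`PeriodicChoice` BY NAME; moves nothing.  HONEST DEPENDENCY: continuum YM on T⁴ ⇐ BetaPertH ∧ nine spine estimates (0/9
proved); BetaPertH ⇐ (D1) ∧ (D4) ∧ CAP+tail; G-an2-4 gates asym, D1 and NE2/3/4.
-/

set_option autoImplicit false

open scoped BigOperators Matrix.Norms.L2Operator
open Finset

namespace Summit.QuantumFields.BalabanUV.T4Continuum.NE3FrameFreeDecompositionPrep

open Literature.MathematicalPhysics.QuantumFieldTheory.Balaban1983to89
open B7Prop1Explicit B7Prop3Flat MatrixNorms
open B7Prop2Explicit (unitaryUnits)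
open T4AveragingDeficitWall (IsSkewDir IsUnitaryCfg Ad)
open T4AveragingDeficitWallBoundary (periodBox mem_periodBox sum_periodBox_shift)
open AveragingDeficitPeriodicCounting (IsPeriodicDir)
open NE3TangentNoGoWords (dPot)
open NE3TangentFlatStructure (Qcoarse Fcoarse framePot framePot_zero framePot_succ dPot_add_period)
open NE3FramePotGauge (cornerGauge frameKill cornerGauge_corner cornerGauge_off_corner)
open NE3CovariantCalculus (hsR hsR_add_left hsR_add_right hsR_sub_left hsR_sub_right hsR_self hsR_comm hsR_sum_left
  hsR_sum_right)
open NE3LandauOrbit (hsR_zero_left hsR_zero_right hsR_neg_right eq_zero_of_nhsNormSq_eq_zero sum_hsR_gaugeDir)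
open NE3CovariantWeitzenbock (covDiv covDiv_flatCfg)
open AveragingDeficitNearIdentity (Ad_one)
open BlockAveragePushDirGauge (gaugeDir)
open NE3CoercivityScaling (flatDiv)
open MinimalActionWitness (flatCfg)
open PeriodicChoice (apply_wrap_eq wrap_mem_periodBox wrap_add_smul_e periodic_vec)
open NE3BlockLineAverage (sum_periodBox_blocks)

noncomputable section

variable {d : ℕ} {n : Type*} [Fintype n] [DecidableEq n]

/-! ## §1 Small algebra: real scalars in `hsR`; skewness of the lattice sums -/

omit [DecidableEq n] in
/-- `hsR (t • X) Y = t · hsR X Y` (real scalar). [folklore] -/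
theorem hsR_smul_left (t : ℝ) (X Y : Matrix n n ℂ) : hsR (t • X) Y = t * hsR X Y := by
  unfold hsR UnitaryModel.nReTr
  rw [Matrix.conjTranspose_smul, star_trivial, Matrix.smul_mul, Matrix.trace_smul]
  simp [Complex.real_smul, mul_div_assoc]

omit [DecidableEq n] in
/-- `hsR X (t • Y) = t · hsR X Y` (real scalar). [folklore] -/
theorem hsR_smul_right (t : ℝ) (X Y : Matrix n n ℂ) : hsR X (t • Y) = t * hsR X Y := by
  rw [hsR_comm, hsR_smul_left, hsR_comm]

/-- `hsR (−X) Y = − hsR X Y`. [folklore] -/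
theorem hsR_neg_left (X Y : Matrix n n ℂ) : hsR (-X) Y = -hsR X Y := by
  have h := hsR_sub_left 0 X Y
  rw [zero_sub, hsR_zero_left] at h
  linarith

/-- The coboundary of a 𝔲(n)-valued site field is 𝔲(n)-valued. [folklore] -/
theorem dPot_mem_skewAdjoint {ξ : Site d → Matrix n n ℂ} (hξ : ∀ x, ξ x ∈ skewAdjoint (Matrix n n ℂ))
    (x : Site d) (μ : Fin d) : dPot ξ x μ ∈ skewAdjoint (Matrix n n ℂ) :=
  (skewAdjoint (Matrix n n ℂ)).sub_mem (hξ _) (hξ _)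

/-- … as a direction field: `IsSkewDir (dPot ξ)`. [folklore] -/
theorem isSkewDir_dPot {ξ : Site d → Matrix n n ℂ} (hξ : ∀ x, ξ x ∈ skewAdjoint (Matrix n n ℂ)) :
    IsSkewDir (dPot ξ) := fun x μ => dPot_mem_skewAdjoint hξ x μ

omit [Fintype n] [DecidableEq n] in
/-- The flat divergence of a skew direction field is 𝔲(n)-valued. [folklore] -/
theorem flatDiv_mem_skewAdjoint {X : Site d → Fin d → Matrix n n ℂ} (hX : IsSkewDir X) (x : Site d) :
    flatDiv X x ∈ skewAdjoint (Matrix n n ℂ) := by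
  unfold flatDiv
  exact AddSubgroup.sum_mem _ fun μ _ => (skewAdjoint (Matrix n n ℂ)).sub_mem (hX _ _) (hX _ _)

/-- A letter step of a skew field is skew. [folklore] -/
theorem stepA_mem_skewAdjoint {X : Site d → Fin d → Matrix n n ℂ} (hX : IsSkewDir X) (x : Site d) (l : Letter d) :
    stepA X x l ∈ skewAdjoint (Matrix n n ℂ) := by
  obtain ⟨μ, b⟩ := l
  cases b
  · simp only [stepA]
    exact (skewAdjoint (Matrix n n ℂ)).neg_mem (hX _ _)
  · simp only [stepA]
    exact hX _ _

/-- Contour sums of a skew field are skew. [folklore] -/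
theorem asum_mem_skewAdjoint {X : Site d → Fin d → Matrix n n ℂ} (hX : IsSkewDir X) :
    ∀ (x : Site d) (w : List (Letter d)), asum X x w ∈ skewAdjoint (Matrix n n ℂ)
  | x, [] => by simp only [asum_nil]; exact (skewAdjoint (Matrix n n ℂ)).zero_mem
  | x, l :: w => by
      rw [asum_cons]
      exact (skewAdjoint (Matrix n n ℂ)).add_mem (stepA_mem_skewAdjoint hX x l) (asum_mem_skewAdjoint hX _ w)

/-- The linearised frame `F̂` of a skew field is skew (real weights). [folklore] -/
theorem Fhat_mem_skewAdjoint (L : ℕ) {X : Site d → Fin d → Matrix n n ℂ} (hX : IsSkewDir X) (q : Site d) :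
    Fhat L X q ∈ skewAdjoint (Matrix n n ℂ) := by
  unfold Fhat
  exact AddSubgroup.sum_mem _ fun r _ => skewAdjoint.smul_mem _ (asum_mem_skewAdjoint hX _ _)

/-- The straight average `linQ` of a skew field is skew (real weights). [folklore] -/
theorem linQ_mem_skewAdjoint (L : ℕ) {X : Site d → Fin d → Matrix n n ℂ} (hX : IsSkewDir X) (q : Site d) (κ : Fin d) :
    linQ L X q κ ∈ skewAdjoint (Matrix n n ℂ) := by
  unfold linQ
  exact AddSubgroup.sum_mem _ fun r _ => skewAdjoint.smul_mem _ (asum_mem_skewAdjoint hX _ _)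

/-- `Qcoarse L` preserves skewness. [folklore] -/
theorem isSkewDir_Qcoarse (L : ℕ) {X : Site d → Fin d → Matrix n n ℂ} (hX : IsSkewDir X) : IsSkewDir (Qcoarse L X) :=
  fun _ κ => linQ_mem_skewAdjoint L hX _ κ

/-- The iterates of `Qcoarse L` preserve skewness. [folklore] -/
theorem isSkewDir_iterate_Qcoarse (L : ℕ) : ∀ (j : ℕ) {X : Site d → Fin d → Matrix n n ℂ}, IsSkewDir X →
    IsSkewDir ((Qcoarse L)^[j] X)
  | 0, _, hX => hX
  | j + 1, _, hX => by
      rw [Function.iterate_succ_apply]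
      exact isSkewDir_iterate_Qcoarse L j (isSkewDir_Qcoarse L hX)

/-- **The frame potential of a skew direction is 𝔲(n)-valued.** [folklore] -/
theorem framePot_mem_skewAdjoint (L : ℕ) : ∀ (k : ℕ) {X : Site d → Fin d → Matrix n n ℂ}, IsSkewDir X →
    ∀ z : Site d, framePot L k X z ∈ skewAdjoint (Matrix n n ℂ)
  | 0, _, _, _ => by rw [framePot_zero]; exact (skewAdjoint (Matrix n n ℂ)).zero_mem
  | k + 1, _, hX, _ => by
      rw [framePot_succ]
      refine (skewAdjoint (Matrix n n ℂ)).add_mem ?_ (framePot_mem_skewAdjoint L k hX _)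
      unfold Fcoarse
      exact Fhat_mem_skewAdjoint L (isSkewDir_iterate_Qcoarse L k hX) _

/-- The corner gauge of a 𝔲(n)-valued block potential is 𝔲(n)-valued. [folklore] -/
theorem cornerGauge_mem_skewAdjoint (M : ℕ) {θ : Site d → Matrix n n ℂ} (hθ : ∀ z, θ z ∈ skewAdjoint (Matrix n n ℂ))
    (x : Site d) : cornerGauge M θ x ∈ skewAdjoint (Matrix n n ℂ) := by
  unfold cornerGauge
  split_ifs
  · exact (skewAdjoint (Matrix n n ℂ)).zero_mem
  · exact hθ _

/-- **The frame-killing gauge of a skew direction is 𝔲(n)-valued.** [folklore] -/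
theorem frameKill_mem_skewAdjoint (L k : ℕ) {X : Site d → Fin d → Matrix n n ℂ} (hX : IsSkewDir X) (x : Site d) :
    frameKill L k X x ∈ skewAdjoint (Matrix n n ℂ) := by
  unfold frameKill
  exact cornerGauge_mem_skewAdjoint _ (fun z => skewAdjoint.smul_mem _ (framePot_mem_skewAdjoint L k hX z)) x

/-! ## §2 Periodicity bookkeeping -/

omit [Fintype n] [DecidableEq n] in
/-- The flat divergence of a `P`-periodic direction field is `P`-periodic. [folklore] -/
theorem flatDiv_add_period {X : Site d → Fin d → Matrix n n ℂ} {P : ℤ} (hX : IsPeriodicDir X P) (x : Site d) (κ : Fin d) :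
    flatDiv X (x + P • e κ) = flatDiv X x := by
  unfold flatDiv
  refine Finset.sum_congr rfl fun μ _ => ?_
  rw [hX, show x + P • e κ - e μ = (x - e μ) + P • e κ by abel, hX]

omit [Fintype n] [DecidableEq n] in
/-- On the period box the wrap map is the identity. [folklore] -/
theorem wrap_eq_self_of_mem {P : ℕ} {x : Site d} (hx : x ∈ periodBox (d := d) P) :
    (fun κ => x κ % (P : ℤ)) = x := by
  funext κ
  obtain ⟨h0, hlt⟩ := mem_periodBox.mp hx κ
  exact Int.emod_eq_of_lt h0 hlt

/-! ## §3 Flat summation by parts -/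

/-- **FLAT SUMMATION BY PARTS ON THE PERIOD TORUS**: for `P ≥ 1`, a `P`-periodic direction field `Z` and a `P`-periodic site
field `η`, `Σ_{x∈periodBox P} Σ_μ hsR (Z x μ) (dPot η x μ) = −Σ_{x∈periodBox P} hsR (flatDiv Z x) (η x)`
(`NE3LandauOrbit.sum_hsR_gaugeDir` at `W = 1`). [folklore] -/
theorem sum_hsR_dPot {P : ℕ} (hP : 1 ≤ P) {Z : Site d → Fin d → Matrix n n ℂ} (hZ : IsPeriodicDir Z (P : ℤ))
    {η : Site d → Matrix n n ℂ} (hη : ∀ (x : Site d) (κ : Fin d), η (x + (P : ℤ) • e κ) = η x) :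
    ∑ x ∈ periodBox (d := d) P, ∑ μ : Fin d, hsR (Z x μ) (dPot η x μ)
      = -∑ x ∈ periodBox (d := d) P, hsR (flatDiv Z x) (η x) := by
  have hU : IsUnitaryCfg (flatCfg (d := d) (n := n)) := fun _ _ => (unitaryUnits (Matrix n n ℂ)).one_mem
  have h := sum_hsR_gaugeDir hP hU hZ hη
  -- at the flat configuration `gaugeDir 1 η = −dPot η` and `covDiv 1 = flatDiv` (cf. leaf-01-g5's
  -- `NE3FrameFreeSliceUnique.gaugeDir_flatCfg_eq_neg_dPot` ∕ `covDiv_flatCfg_eq_flatDiv`, same one-liners)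
  have hg : ∀ (x : Site d) (μ : Fin d), gaugeDir (flatCfg (d := d) (n := n)) η x μ = -dPot η x μ := fun x μ => by
    simp only [gaugeDir, flatCfg, inv_one, Ad_one, dPot, neg_sub]
  have hc : ∀ x : Site d, covDiv (flatCfg (d := d) (n := n)) Z x = flatDiv Z x := fun x => covDiv_flatCfg Z x
  simp only [hg, hc, hsR_neg_right, Finset.sum_neg_distrib] at h
  linarith

/-! ## §4 `dPot` is injective on corner-trivial periodic fields -/

/-- A site field with vanishing coboundary is constant. [folklore] -/
theorem eq_apply_zero_of_dPot_eq_zero {ξ : Site d → Matrix n n ℂ} (h : ∀ (x : Site d) (μ : Fin d), dPot ξ x μ = 0)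
    (x : Site d) : ξ x = ξ 0 := by
  have hper : ∀ (y : Site d) (κ : Fin d), ξ (y + (1 : ℤ) • e κ) = ξ y := by
    intro y κ
    rw [one_smul]
    exact sub_eq_zero.mp (h y κ)
  have := periodic_vec hper 0 x
  rwa [one_smul, zero_add] at this

/-- **THE GRAM FORM OF `dPot` IS DEFINITE ON CORNER-TRIVIAL PERIODIC FIELDS**: for `P ≥ 1` and a `P`-periodic `η` with
`η 0 = 0`, `Σ_{x∈periodBox P} Σ_μ nhsNormSq (dPot η x μ) = 0` forces `η = 0`. [folklore] -/
theorem eq_zero_of_sum_nhsNormSq_dPot_eq_zero {P : ℕ} (hP : 1 ≤ P) {η : Site d → Matrix n n ℂ}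
    (hη : ∀ (x : Site d) (κ : Fin d), η (x + (P : ℤ) • e κ) = η x) (h0 : η 0 = 0)
    (h : ∑ x ∈ periodBox (d := d) P, ∑ μ : Fin d, nhsNormSq (dPot η x μ) = 0) : η = 0 := by
  have hbox : ∀ x ∈ periodBox (d := d) P, ∀ μ : Fin d, dPot η x μ = 0 := by
    intro x hx μ
    have h1 := (Finset.sum_eq_zero_iff_of_nonneg fun y _ => Finset.sum_nonneg fun ν _ => nhsNormSq_nonneg (dPot η y ν)).1
      h x hx
    have h2 := (Finset.sum_eq_zero_iff_of_nonneg fun ν _ => nhsNormSq_nonneg (dPot η x ν)).1 h1 μ (Finset.mem_univ _)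
    exact eq_zero_of_nhsNormSq_eq_zero h2
  have hall : ∀ (x : Site d) (μ : Fin d), dPot η x μ = 0 := by
    intro x μ
    have hw : dPot η (fun κ => x κ % (P : ℤ)) μ = dPot η x μ :=
      apply_wrap_eq (g := fun y => dPot η y μ) (fun y κ => dPot_add_period hη y κ μ) x
    rw [← hw]
    exact hbox _ (wrap_mem_periodBox P hP x) μ
  funext x
  rw [eq_apply_zero_of_dPot_eq_zero hall x, h0]
  rfl

/-! ## §5 A blockwise-constant divergence pairs to zero with a corner-trivial block-mean-zero gauge -/

/-- **THE PAIRING VANISHES**: if `D` is blockwise constant off the block corners (`D (M•z + v) = c_z` for `v ∈ [0,M)^d`,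
`v ≠ 0`) and `η` is corner-trivial with zero block sums, then `Σ_{x∈periodBox (M·N)} hsR (D x) (η x) = 0` (`M ≥ 1`). [folklore] -/
theorem sum_hsR_eq_zero_of_blockConst {M : ℕ} (hM : 1 ≤ M) (N : ℕ) {D η : Site d → Matrix n n ℂ}
    (hD : ∀ z : Site d, ∃ c : Matrix n n ℂ, ∀ v ∈ periodBox (d := d) M, v ≠ 0 → D ((M : ℤ) • z + v) = c)
    (hη0 : ∀ w : Site d, η ((M : ℤ) • w) = 0) (hηb : ∀ z : Site d, ∑ v ∈ periodBox (d := d) M, η ((M : ℤ) • z + v) = 0) :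
    ∑ x ∈ periodBox (d := d) (M * N), hsR (D x) (η x) = 0 := by
  rw [← sum_periodBox_blocks M N hM]
  refine Finset.sum_eq_zero fun z _ => ?_
  obtain ⟨c, hc⟩ := hD z
  have hterm : ∀ v ∈ periodBox (d := d) M, hsR (D ((M : ℤ) • z + v)) (η ((M : ℤ) • z + v)) = hsR c (η ((M : ℤ) • z + v)) := by
    intro v hv
    by_cases hv0 : v = 0
    · subst hv0
      rw [add_zero, hη0, hsR_zero_right, hsR_zero_right]
    · rw [hc v hv hv0]
  rw [Finset.sum_congr rfl hterm, ← hsR_sum_right, hηb z, hsR_zero_right]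

end

end Summit.QuantumFields.BalabanUV.T4Continuum.NE3FrameFreeDecompositionPrep
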